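import Literature.MathematicalPhysics.QuantumFieldTheory.Balaban1983to89.B7Prop7BackgroundModulusLevels
import Literature.MathematicalPhysics.QuantumFieldTheory.Balaban1983to89.B7Prop5Cplx

/-!
# `Balaban1983to89.B7Prop7KernelBackgroundModulusLevels` — T. Bałaban, *Averaging operations for lattice gauge theories*, Commun. Math. Phys. **98** (1985) 17–51
# [Balaban1985Averaging] Proposition 7 p. 43 («the function Q_k(U′U₀, ηA) is analytic in complex variables A′, A … Similarly, Proposition 5 may be extended to include analyticity
# and uniformity statements»), Proposition 5 (157) p. 42 («|(δ/δA_b)C_k(U₀, A, c)| ≦ C₃|A|»), (137) p. 39, (130)–(134) p. 38: **THE KERNEL OF `C_k(V, ·)` — THE LINE DERIVATIVE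
# `dC_k(V; B; X·δ_b)(c)` — IS LIPSCHITZ IN THE BACKGROUND AT THE FLAT POINT, UNIFORMLY IN THE NUMBER OF LEVELS, WITH THE `L^{−kd}` OF (157)** — for a background `V` with
# `‖V(b) − 1‖ ≤ ε` (`6ε ≤ ρ′`) and a field `‖B(b)‖ ≤ b` in Prop. 5's complex regime: `‖dC_k(V; B; Xδ_b)(c) − dC_k(1; B; Xδ_b)(c)‖ ≤ (6∕(Lᵏρ′))·(Lᵏε)·C₃(Lᵏ)²L^{−kd}b‖X‖`
# — a CAUCHY ESTIMATE along `τ ↦ e^{τ log V}` on the kernel entry: the uniform bound is lit-balaban p06's `B7Prop5Cplx.prop5_cplx_157_uniform` (Prop. 5 at the complex background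
# `e^{B′}U₀` UNIFORMLY in `‖B′‖ ≤ ρ′`, with the locality factor `L^{−kd}`); the analyticity of the entry in `τ` is that of `∂_s Q_k(e^{τX}, B + sD)(c)` and `∂_s Q_k(e^{τX}, sD)(c)` (the entry
# is their difference: (156) `prop5_cplx_156_uniform` and (134) `B7Prop7BackgroundModulusLevels.hasDerivAt_logCovIter_line`), both `∂_s` of a map jointly analytic in `(τ, s) ∈ ℂ²`
# (`B7Prop7Levels.prop7_analyticAt` with parameter space `ℂ × ℂ`, then Mathlib's `AnalyticAt.fderiv`).  The kernel twin of this lineage's gen-104 `B7Prop7BackgroundModulusLevels`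
# (the VALUE modulus, which loses the `L^{−kd}` if differentiated); the brick `δg` (background part) of the NE9 chain's two-background `C_k`-kernel letter.  NE9 crux-team LEAF PROVER
# 01 (`b2b-balaban-t4-ne9-formalise-leaf-01`), gen 105; cell `pub-balaban`∕`t4`, row NE9, bears_on R4/N22; source READ first-hand (pp. 38–43) through the verbatim quotations of
# `B7Prop5Cplx` ∕ `B7Prop7Levels`; composition BY NAME; nothing printed is a hypothesis beyond Prop. 5∕7's regime DISPLAYED as smallness inequalities.
# WHAT IS PROVED (sorry-free; 0 `def`): `analyticAt_dCov_background_line` (the kernel entry as a difference of two `∂_s` of jointly analytic maps), **`norm_dCov_sub_flat_le`**,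
# `dCov_sub_flat_eq_zero_off` (locality of the difference); §3 the field twin at the flat background: `analyticAt_dCov_field_line`, **`norm_dCov_flat_sub_le`** (`≤ (24∕b)·δ·C₃(Lᵏ)²L^{−kd}b‖X‖`).  HONEST SCOPE: [folklore] Cauchy estimates on LANDED analyticity ∕ bounds; crude constants;
# the flat base only (`U₀ = 1`); «NE9 ⇐ the named binders»; NE9 NOT PRINTED ∕ NOT PROVED; spine PROVED 0∕9; rung (B)+1 finite T⁴ — NOT infinite volume, NOT mass gap, NOT BetaPertH,
# NOT Clay.  HONEST DEPENDENCY: continuum YM on T⁴ ⇐ BetaPertH ∧ nine spine estimates (0/9 proved); BetaPertH ⇐ (D1) ∧ (D4) ∧ CAP+tail; G-an2-4 gates asym, D1 and NE2/3/4.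

statement-level skeleton of published theorems with citation tags; proofs where landed; nothing here is a claim about the Yang–Mills mass gap
-/

noncomputable section

open scoped BigOperators
open NormedSpace Metric Set

namespace Literature.MathematicalPhysics.QuantumFieldTheory.Balaban1983to89.B7Prop7KernelBackgroundModulusLevels

open B7Prop1Explicit B7Prop2Explicit B7Prop3Flat MatrixLog B7Prop3GeneralLinear B7Prop4GeneralLevels B7Prop7Levels B7Prop7Ins
open B7Prop5Flat (bump norm_bump_le BondIn)
open B7Prop1Local (loK bondHiK)
open B7Prop5GeneralInduction (CCovIter dCov)
open B7Prop5CplxLevels (epsCplx tauCplx C3Cplx)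
open B7Prop5Cplx (prop5_cplx_157_uniform prop5_cplx_156_uniform)
open B7Eq123BackgroundModulus (expCfg_zero' expCfg_mlog)
open B7Prop7BackgroundModulusLevels (hasDerivAt_logCovIter_line)
open B13Contraction113 (norm_sub_le_of_sphere_bound)

export B7Prop1Explicit (Site)

variable {d : ℕ} {𝔸 : Type*} [NormedRing 𝔸] [NormedAlgebra ℂ 𝔸] [CompleteSpace 𝔸] [NormOneClass 𝔸]
  (L : ℕ) (hL : 2 ≤ L) {G : Subgroup 𝔸ˣ} (hG : AvgClosed d L G) (k : ℕ) {α₀ : ℝ} (hα : 0 < α₀)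
  (hα3 : C0 d * α₀ ≤ 1 / 3) (hα8 : 8 * α₀ ≤ c2' d L)
  {ρ' b : ℝ} (hρ' : 0 < ρ') (hb0 : 0 < b)
  -- Prop. 7's regime in the background variable `‖B′‖ ≤ ρ′` ((130)∕(131), (164))
  (hsmall' : Real.exp (4 * (800 * ((d : ℝ) + 1) ^ 2 * ((d : ℝ) + 4)) * α₀)
    * (1 + 8 * (131072 * ((d : ℝ) + 1) ^ 2) * ((L : ℝ) ^ k * ρ')) ≤ 2)
  (hc₃' : 2 * ((L : ℝ) ^ k * ρ') ≤ c3 d L) (hρ'1 : 409600 * ((d : ℝ) + 1) ^ 2 * ((L : ℝ) ^ k * ρ') ≤ 1)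
  -- Prop. 5's complex regime: the step conditions (145)∕(155) «α₀, α₁ sufficiently small» and the field size `‖B‖ ≤ b`
  (hE : epsCplx d L ρ' k ≤ 1 / 16) (hdX : (d : ℝ) * (epsCplx d L ρ' k + tauCplx d L α₀ k ρ' k) ≤ 1 / 16)
  (hsmall : Real.exp (4480 * ((d : ℝ) + 1) ^ 2 * ((d : ℝ) + 4) * α₀ + 240000 * ((d : ℝ) + 1) ^ 3 * ((L : ℝ) ^ k * ρ'))
    * (1 + 8 * (2097152 * ((d : ℝ) + 1) ^ 2) * ((L : ℝ) ^ k * b)) ≤ 2)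
  (hc₃ : 16 * ((L : ℝ) ^ k * b) < c3 d L) (hβ : (d : ℝ) * C3Cplx d L * ((L : ℝ) ^ k * b) ≤ 1)

omit [NormedAlgebra ℂ 𝔸] [CompleteSpace 𝔸] [NormOneClass 𝔸] in
/-- (52) at the vacuum: the plaquette deviation of `1` vanishes. [cite: Balaban1985Averaging, Proposition 2 (52) p.26, (9) p.18] -/
private theorem hol_one : ∀ (x : Site d) (w : List (B7Prop1Explicit.Letter d)), hol (1 : Site d → Fin d → 𝔸ˣ) x w = 1
  | _, [] => rfl
  | x, l :: w => by rw [B7Prop1Explicit.hol_cons, hol_one (x + l.vec) w, mul_one]; simp [stepHol]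

omit [NormedAlgebra ℂ 𝔸] [CompleteSpace 𝔸] [NormOneClass 𝔸] in
include hL hα in
/-- (52) holds at `U₀ = 1` for every `α₀ > 0`. [cite: Balaban1985Averaging, Proposition 2 (52) p.26] -/
private theorem pdev_one_lt : pdev (1 : Site d → Fin d → 𝔸ˣ) < α₀ * (((L : ℝ) ^ k)⁻¹) ^ 2 := by
  have hpdev : pdev (1 : Site d → Fin d → 𝔸ˣ) = 0 := by unfold pdev; simp [hol_one]
  rw [hpdev]
  have : (0 : ℝ) < L := by exact_mod_cast (lt_of_lt_of_le (by norm_num) hL : 0 < L)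
  positivity

/-! ## §1 The kernel entry at a complex background as a difference of two `∂_s` of jointly analytic maps; its analyticity in the background variable -/

include hL hG hα hα3 hα8 hρ' hb0 hsmall' hc₃' hρ'1 hE hdX hsmall hc₃ hβ in
/-- **THE KERNEL ENTRY `τ ↦ dC_k(e^{τX}; B; D)(c)` IS ANALYTIC ON THE DISC `‖τX‖ < ρ′`** — at every `τ` of the disc the entry equals
`∂_s Q_k(e^{τX}, B + sD)(c)|₀ − ∂_s Q_k(e^{τX}, sD)(c)|₀` ((156): the line derivative of `Q_k(W, ·)` at `B` along `D = Xδ_b` is `dC_k + LᵏηQ_k(W)D`; (134): that of `Q_k(W, ·)` at `0` is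
`LᵏηQ_k(W)D`), both maps `(τ, s) ↦ Q_k(e^{τX}, B + sD)(c)`, `(τ, s) ↦ Q_k(e^{τX}, sD)(c)` being jointly analytic on `ℂ²` near `(τ, 0)` (`prop7_analyticAt`, parameter space `ℂ × ℂ`); hence
the entry is the difference of two `∂_s`-slices of analytic maps, analytic in `τ` (`AnalyticAt.fderiv`). [folklore] [cite: Balaban1985Averaging, Proposition 7 p.43, (156)–(157) p.42, (134) p.38] -/
theorem analyticAt_dCov_background_line (X : Site d → Fin d → 𝔸) {R : ℝ} (hXR : ∀ τ : ℂ, ‖τ‖ < R → ∀ x κ, ‖(τ • X) x κ‖ ≤ ρ')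
    (B : Site d → Fin d → 𝔸) (hB : ∀ x κ, ‖B x κ‖ ≤ b) (y : Site d) (μ : Fin d) (Xf : 𝔸) (z : Site d) (κ : Fin d) {τ : ℂ} (hτ : ‖τ‖ < R) :
    AnalyticAt ℂ (fun τ' : ℂ => dCov L (expCfg (τ' • X) * 1) B (bump y μ Xf) k z κ) τ := by
  have hU₀ : ∀ (x : Site d) (κ' : Fin d), (1 : Site d → Fin d → 𝔸ˣ) x κ' ∈ G := fun _ _ => G.one_mem
  have h52 := pdev_one_lt (d := d) (𝔸 := 𝔸) L hL k hα
  have hc₃₇ : 2 * ((L : ℝ) ^ k * b) ≤ c3 d L / 4 := by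
    have hx : (0 : ℝ) ≤ (L : ℝ) ^ k * b := by have := hb0.le; positivity
    linarith
  set D : Site d → Fin d → 𝔸 := bump y μ Xf with hD
  have hDn : ∀ x κ', ‖D x κ'‖ ≤ ‖Xf‖ := fun x κ' => norm_bump_le y μ Xf x κ'
  -- the two jointly analytic maps on `ℂ × ℂ`
  set H₁ : ℂ × ℂ → 𝔸 := fun t => logCovIter L (expCfg (t.1 • X) * 1) (B + t.2 • D) k z κ with hH₁
  set H₂ : ℂ × ℂ → 𝔸 := fun t => logCovIter L (expCfg (t.1 • X) * 1) (t.2 • D) k z κ with hH₂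
  have hA₁ : ∀ τ' : ℂ, ‖τ'‖ < R → AnalyticAt ℂ H₁ (τ', 0) := fun τ' hτ' =>
    prop7_analyticAt L hL hG k 1 hU₀ hα hα3 hα8 h52 (E := ℂ × ℂ) (fun t : ℂ × ℂ => t.1 • X) (t₀ := (τ', 0))
      (fun x κ' => (analyticAt_fst.smul analyticAt_const : AnalyticAt ℂ (fun t : ℂ × ℂ => (t.1 • X) x κ') (τ', 0))) hρ'.le (hXR τ' hτ')
      hsmall' hc₃' hρ'1 (fun t : ℂ × ℂ => B + t.2 • D)
      (fun x κ' => (analyticAt_const.add (analyticAt_snd.smul analyticAt_const) : AnalyticAt ℂ (fun t : ℂ × ℂ => (B + t.2 • D) x κ') (τ', 0)))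
      hb0.le (fun x κ' => by simpa using hB x κ') hsmall hc₃₇ k le_rfl z κ
  have hA₂ : ∀ τ' : ℂ, ‖τ'‖ < R → AnalyticAt ℂ H₂ (τ', 0) := fun τ' hτ' =>
    prop7_analyticAt L hL hG k 1 hU₀ hα hα3 hα8 h52 (E := ℂ × ℂ) (fun t : ℂ × ℂ => t.1 • X) (t₀ := (τ', 0))
      (fun x κ' => (analyticAt_fst.smul analyticAt_const : AnalyticAt ℂ (fun t : ℂ × ℂ => (t.1 • X) x κ') (τ', 0))) hρ'.le (hXR τ' hτ')
      hsmall' hc₃' hρ'1 (fun t : ℂ × ℂ => t.2 • D)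
      (fun x κ' => (analyticAt_snd.smul analyticAt_const : AnalyticAt ℂ (fun t : ℂ × ℂ => (t.2 • D) x κ') (τ', 0)))
      hb0.le (fun x κ' => by simpa using hb0.le) hsmall hc₃₇ k le_rfl z κ
  -- the curve `s ↦ (τ′, s)`
  have hcurve : ∀ τ' : ℂ, HasDerivAt (fun s : ℂ => ((τ', s) : ℂ × ℂ)) ((0 : ℂ), (1 : ℂ)) 0 := fun τ' =>
    (hasDerivAt_const (0 : ℂ) τ').prodMk (hasDerivAt_id (0 : ℂ))
  -- the entry as a difference of the two `∂_s`-slices, on the whole disc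
  have hEq : ∀ τ' : ℂ, ‖τ'‖ < R → dCov L (expCfg (τ' • X) * 1) B D k z κ = (fderiv ℂ H₁ (τ', 0)) (0, 1) - (fderiv ℂ H₂ (τ', 0)) (0, 1) := by
    intro τ' hτ'
    have h156 := (prop5_cplx_156_uniform L hL hG k 1 hU₀ hα hα3 hα8 h52 (τ' • X) hρ'.le (hXR τ' hτ') hsmall' hc₃' hρ'1 hE hdX B hb0.le hB hsmall hc₃ hβ
      y μ Xf le_rfl z κ).1
    have hd₁ : HasDerivAt (fun s : ℂ => logCovIter L (expCfg (τ' • X) * 1) (B + s • D) k z κ)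
        (dCov L (expCfg (τ' • X) * 1) B D k z κ + linCovIter L (expCfg (τ' • X) * 1) D k z κ) 0 := h156
    have hd₁' : HasDerivAt (fun s : ℂ => logCovIter L (expCfg (τ' • X) * 1) (B + s • D) k z κ) ((fderiv ℂ H₁ (τ', 0)) (0, 1)) 0 := by
      have h := ((hA₁ τ' hτ').differentiableAt.hasFDerivAt.comp_hasDerivAt (0 : ℂ) (hcurve τ'))
      simp only [hH₁, Function.comp_def] at h
      exact h
    have hd₂ : HasDerivAt (fun s : ℂ => logCovIter L (expCfg (τ' • X) * 1) (s • D) k z κ) (linCovIter L (expCfg (τ' • X) * 1) D k z κ) 0 :=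
      hasDerivAt_logCovIter_line L hL hG k hα hα3 hα8 hb0 hsmall' hc₃' hρ'1 hsmall hc₃₇ (τ' • X) hρ'.le (hXR τ' hτ') le_rfl D (norm_nonneg Xf) hDn z κ
    have hd₂' : HasDerivAt (fun s : ℂ => logCovIter L (expCfg (τ' • X) * 1) (s • D) k z κ) ((fderiv ℂ H₂ (τ', 0)) (0, 1)) 0 := by
      have h := ((hA₂ τ' hτ').differentiableAt.hasFDerivAt.comp_hasDerivAt (0 : ℂ) (hcurve τ'))
      simp only [hH₂, Function.comp_def] at h
      exact h
    have e₁ := hd₁.unique hd₁'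
    have e₂ := hd₂.unique hd₂'
    rw [e₂] at e₁
    exact eq_sub_of_add_eq e₁
  -- analyticity of the two slices in `τ′`
  have hS : ∀ {H : ℂ × ℂ → 𝔸}, AnalyticAt ℂ H (τ, 0) → AnalyticAt ℂ (fun τ' : ℂ => (fderiv ℂ H (τ', 0)) (0, 1)) τ := fun {H} hH => by
    have hf : AnalyticAt ℂ (fun τ' : ℂ => ((τ', (0 : ℂ)) : ℂ × ℂ)) τ := analyticAt_id.prod analyticAt_const
    have h1 : AnalyticAt ℂ ((fderiv ℂ H) ∘ (fun τ' : ℂ => ((τ', (0 : ℂ)) : ℂ × ℂ))) τ := hH.fderiv.comp_of_eq hf rfl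
    exact ((ContinuousLinearMap.apply ℂ 𝔸 ((0 : ℂ), (1 : ℂ))).analyticAt _).comp h1
  have hev : (fun τ' : ℂ => dCov L (expCfg (τ' • X) * 1) B D k z κ) =ᶠ[nhds τ]
      fun τ' : ℂ => (fderiv ℂ H₁ (τ', 0)) (0, 1) - (fderiv ℂ H₂ (τ', 0)) (0, 1) := by
    filter_upwards [isOpen_ball.mem_nhds (mem_ball_zero_iff.2 hτ)] with τ' hτ'
    exact hEq τ' (mem_ball_zero_iff.1 hτ')
  exact ((hS (hA₁ τ hτ)).sub (hS (hA₂ τ hτ))).congr hev.symm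

/-! ## §2 The kernel entry is Lipschitz in the background at the flat point, uniformly in `k`, with the `L^{−kd}` of (157) -/

include hL hG hα hα3 hα8 hρ' hb0 hsmall' hc₃' hρ'1 hE hdX hsmall hc₃ hβ in
/-- **`‖dC_k(V; B; Xδ_b)(c) − dC_k(1; B; Xδ_b)(c)‖ ≤ (6∕(Lᵏρ′))·(Lᵏε)·C₃(Lᵏ)²L^{−kd}b‖X‖`** for `‖V(b) − 1‖ ≤ ε` with `6ε ≤ ρ′` and `‖B(b)‖ ≤ b` — Prop. 7's analyticity in the background
read as a Lipschitz modulus of the KERNEL at the vacuum: `g(τ) = dC_k(e^{τ log V}; B; Xδ_b)(c)` is analytic on `|τ| < R := ρ′∕(2ε)` (§1, `|log V| ≤ 2ε`) with the uniform bound (157)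
`‖g(τ)‖ ≤ C₃(Lᵏ)²L^{−kd}b‖X‖` (`prop5_cplx_157_uniform` at `b′ := ρ′`); Cauchy on circles of radius `R − 2` around `[0,1]` (`norm_sub_le_of_sphere_bound`), `M∕(R − 2) ≤ 3M∕R`.
[folklore] [cite: Balaban1985Averaging, Proposition 7 p.43, Prop. 5 (157) p.42, (137) p.39] -/
theorem norm_dCov_sub_flat_le (V : Site d → Fin d → 𝔸ˣ) {ε : ℝ} (hε : 0 ≤ ε) (hVε : ∀ x κ, ‖((V x κ : 𝔸ˣ) : 𝔸) - 1‖ ≤ ε) (hερ : 6 * ε ≤ ρ')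
    (B : Site d → Fin d → 𝔸) (hB : ∀ x κ, ‖B x κ‖ ≤ b) (y : Site d) (μ : Fin d) (Xf : 𝔸) (z : Site d) (κ : Fin d) :
    ‖dCov L V B (bump y μ Xf) k z κ - dCov L 1 B (bump y μ Xf) k z κ‖ ≤
      6 / ((L : ℝ) ^ k * ρ') * ((L : ℝ) ^ k * ε) * (C3Cplx d L * ((L : ℝ) ^ k) ^ 2 * (((L : ℝ) ^ k) ^ d)⁻¹ * b * ‖Xf‖) := by
  have hLk : (0 : ℝ) < (L : ℝ) ^ k := pow_pos (by exact_mod_cast (lt_of_lt_of_le (by norm_num) hL : 0 < L)) k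
  have hL1 : 1 ≤ L := le_trans (by norm_num) hL
  have hC30 : 0 ≤ C3Cplx d L := (B7Prop5CplxLevels.C3Cplx_pos d hL1).le
  set M : ℝ := C3Cplx d L * ((L : ℝ) ^ k) ^ 2 * (((L : ℝ) ^ k) ^ d)⁻¹ * b * ‖Xf‖ with hMdef
  have hM0 : 0 ≤ M := by rw [hMdef]; have := hb0.le; positivity
  rcases hε.eq_or_lt with h0 | hpos
  · -- `ε = 0`: the background IS flat
    have hV1 : V = 1 := by
      funext x κ'
      have h := hVε x κ'
      rw [← h0] at h
      exact Units.ext (by simpa [sub_eq_zero] using norm_le_zero_iff.1 h)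
    rw [hV1, sub_self, norm_zero, ← h0]; positivity
  have hU₀ : ∀ (x : Site d) (κ' : Fin d), (1 : Site d → Fin d → 𝔸ˣ) x κ' ∈ G := fun _ _ => G.one_mem
  have h52 := pdev_one_lt (d := d) (𝔸 := 𝔸) L hL k hα
  -- the logarithm of the background
  have hε1 : ρ' ≤ 1 / 2 := by
    have h1 : (1 : ℝ) ≤ (L : ℝ) ^ k := one_le_pow₀ (by exact_mod_cast hL1)
    have h2 : (1 : ℝ) ≤ ((d : ℝ) + 1) ^ 2 := one_le_pow₀ (by linarith [(Nat.cast_nonneg d : (0 : ℝ) ≤ d)])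
    have h3 : ρ' ≤ (L : ℝ) ^ k * ρ' := le_mul_of_one_le_left hρ'.le h1
    have h4 : (L : ℝ) ^ k * ρ' ≤ ((d : ℝ) + 1) ^ 2 * ((L : ℝ) ^ k * ρ') := le_mul_of_one_le_left (by positivity) h2
    linarith
  have hε2 : ε ≤ 1 / 2 := by linarith
  set X : Site d → Fin d → 𝔸 := fun x κ' => mlog ((V x κ' : 𝔸ˣ) : 𝔸) with hXdef
  have hX : ∀ x κ', ‖X x κ'‖ ≤ 2 * ε := fun x κ' => (norm_mlog_le_two_mul ((hVε x κ').trans hε2)).trans (by linarith [hVε x κ'])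
  have hVexp : expCfg X = V := expCfg_mlog V fun x κ' => (hVε x κ').trans_lt (by linarith)
  -- the radius of analyticity in the background variable
  set R : ℝ := ρ' / (2 * ε) with hRdef
  have hR : 0 < R := by rw [hRdef]; positivity
  have hR3 : 3 ≤ R := by rw [hRdef, le_div_iff₀ (by positivity)]; linarith
  have hRε : 2 * R * ε = ρ' := by rw [hRdef]; field_simp
  have hτX : ∀ τ : ℂ, ‖τ‖ < R → ∀ x κ', ‖(τ • X) x κ'‖ ≤ ρ' := fun τ hτ x κ' => by
    rw [Pi.smul_apply, Pi.smul_apply, norm_smul]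
    calc ‖τ‖ * ‖X x κ'‖ ≤ R * (2 * ε) := mul_le_mul hτ.le (hX x κ') (norm_nonneg _) hR.le
      _ = ρ' := by rw [← hRε]; ring
  -- the family `g(τ) = dC_k(e^{τX}; B; D)(c)`
  set g : ℂ → 𝔸 := fun τ => dCov L (expCfg (τ • X) * 1) B (bump y μ Xf) k z κ with hgdef
  have g1 : g 1 = dCov L V B (bump y μ Xf) k z κ := by simp only [hgdef, one_smul, hVexp, mul_one]
  have g0 : g 0 = dCov L 1 B (bump y μ Xf) k z κ := by simp only [hgdef, zero_smul, expCfg_zero', mul_one]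
  -- analyticity on the disc (§1)
  have hd : DifferentiableOn ℂ g (ball (0 : ℂ) R) := fun τ hτ =>
    (analyticAt_dCov_background_line L hL hG k hα hα3 hα8 hρ' hb0 hsmall' hc₃' hρ'1 hE hdX hsmall hc₃ hβ X hτX B hB y μ Xf z κ
      (mem_ball_zero_iff.1 hτ)).differentiableAt.differentiableWithinAt
  -- the uniform bound (157) on the disc
  have hM : ∀ τ : ℂ, ‖τ‖ < R → ‖g τ‖ ≤ M := fun τ hτ =>
    (prop5_cplx_157_uniform L hL hG k 1 hU₀ hα hα3 hα8 h52 (τ • X) hρ'.le (hτX τ hτ) hsmall' hc₃' hρ'1 hE hdX B hb0.le hB hsmall hc₃ hβ y μ Xf le_rfl z κ).2.1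
  -- Cauchy on circles of radius `R − 2` around `[0, 1]`
  have hr : 0 < R - 2 := by linarith
  have hsub : ∀ t : ℝ, t ∈ Icc (0 : ℝ) 1 → closedBall (t : ℂ) (R - 2) ⊆ ball (0 : ℂ) R := fun t ht w hw => by
    rw [mem_closedBall, dist_eq_norm] at hw
    rw [mem_ball_zero_iff]
    have ht1 : ‖(t : ℂ)‖ ≤ 1 := by rw [Complex.norm_real, Real.norm_of_nonneg ht.1]; exact ht.2
    calc ‖w‖ = ‖(w - t) + t‖ := by rw [sub_add_cancel]
      _ ≤ ‖w - (t : ℂ)‖ + ‖(t : ℂ)‖ := norm_add_le _ _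
      _ < R := by linarith
  have hMs : ∀ t : ℝ, t ∈ Icc (0 : ℝ) 1 → ∀ w ∈ sphere (t : ℂ) (R - 2), ‖g w‖ ≤ M := fun t ht w hw =>
    hM w (mem_ball_zero_iff.1 (hsub t ht (sphere_subset_closedBall hw)))
  have hC := norm_sub_le_of_sphere_bound isOpen_ball hd hr hsub hMs
  rw [g1, g0] at hC
  refine hC.trans ?_
  have hR2 : R / 3 ≤ R - 2 := by linarith
  calc M / (R - 2) ≤ M / (R / 3) := div_le_div_of_nonneg_left hM0 (by positivity) hR2
    _ = 6 / ((L : ℝ) ^ k * ρ') * ((L : ℝ) ^ k * ε) * M := by rw [hRdef]; field_simp; ring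

include hL hG hα hα3 hα8 hρ' hb0 hsmall' hc₃' hρ'1 hE hdX hsmall hc₃ hβ in
/-- **LOCALITY OF THE DIFFERENCE**: the kernel entries at `V` and at `1` both vanish unless `b ⊂ Bᵏ(c₋) ∪ Bᵏ(c₊)` ((157) «zero unless …», `prop5_cplx_157_uniform` at `B′ := log V` and at
`B′ := 0`), hence so does their difference. [folklore] [cite: Balaban1985Averaging, Prop. 5 (157) p.42, (141) p.39] -/
theorem dCov_sub_flat_eq_zero_off (V : Site d → Fin d → 𝔸ˣ) {ε : ℝ} (_hε : 0 ≤ ε) (hVε : ∀ x κ, ‖((V x κ : 𝔸ˣ) : 𝔸) - 1‖ ≤ ε) (hερ : 6 * ε ≤ ρ')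
    (B : Site d → Fin d → 𝔸) (hB : ∀ x κ, ‖B x κ‖ ≤ b) (y : Site d) (μ : Fin d) (Xf : 𝔸) (z : Site d) (κ : Fin d)
    (hoff : ¬ BondIn (loK L k z) (bondHiK L k z κ) y μ) :
    dCov L V B (bump y μ Xf) k z κ - dCov L 1 B (bump y μ Xf) k z κ = 0 := by
  have hL1 : 1 ≤ L := le_trans (by norm_num) hL
  have hU₀ : ∀ (x : Site d) (κ' : Fin d), (1 : Site d → Fin d → 𝔸ˣ) x κ' ∈ G := fun _ _ => G.one_mem
  have h52 := pdev_one_lt (d := d) (𝔸 := 𝔸) L hL k hα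
  have hε1 : ρ' ≤ 1 / 2 := by
    have hLk : (1 : ℝ) ≤ (L : ℝ) ^ k := one_le_pow₀ (by exact_mod_cast hL1)
    have h2 : (1 : ℝ) ≤ ((d : ℝ) + 1) ^ 2 := one_le_pow₀ (by linarith [(Nat.cast_nonneg d : (0 : ℝ) ≤ d)])
    have h3 : ρ' ≤ (L : ℝ) ^ k * ρ' := le_mul_of_one_le_left hρ'.le hLk
    have h4 : (L : ℝ) ^ k * ρ' ≤ ((d : ℝ) + 1) ^ 2 * ((L : ℝ) ^ k * ρ') := le_mul_of_one_le_left (by positivity) h2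
    linarith
  have hε2 : ε ≤ 1 / 2 := by linarith
  set X : Site d → Fin d → 𝔸 := fun x κ' => mlog ((V x κ' : 𝔸ˣ) : 𝔸) with hXdef
  have hX : ∀ x κ', ‖X x κ'‖ ≤ ρ' := fun x κ' => by
    have h1 := norm_mlog_le_two_mul ((hVε x κ').trans hε2)
    have h2 := hVε x κ'
    show ‖mlog ((V x κ' : 𝔸ˣ) : 𝔸)‖ ≤ ρ'
    linarith
  have hVexp : expCfg X * 1 = V := by rw [mul_one]; exact expCfg_mlog V fun x κ' => (hVε x κ').trans_lt (by linarith)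
  have h1exp : expCfg (0 : Site d → Fin d → 𝔸) * 1 = 1 := by rw [expCfg_zero', mul_one]
  have h0' : ∀ x κ', ‖(0 : Site d → Fin d → 𝔸) x κ'‖ ≤ ρ' := fun _ _ => by simpa using hρ'.le
  have hV := (prop5_cplx_157_uniform L hL hG k 1 hU₀ hα hα3 hα8 h52 X hρ'.le hX hsmall' hc₃' hρ'1 hE hdX B hb0.le hB hsmall hc₃ hβ y μ Xf le_rfl z κ).2.2 hoff
  have h1 := (prop5_cplx_157_uniform L hL hG k 1 hU₀ hα hα3 hα8 h52 0 hρ'.le h0' hsmall' hc₃' hρ'1 hE hdX B hb0.le hB hsmall hc₃ hβ y μ Xf le_rfl z κ).2.2 hoff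
  rw [hVexp] at hV
  rw [h1exp] at h1
  rw [hV, h1, sub_zero]

/-! ## §3 The kernel entry at the flat background is Lipschitz in the field base point, with the `L^{−kd}` of (157) -/

include hL hG hα hα3 hα8 hρ' hb0 hsmall' hc₃' hρ'1 hE hdX hsmall hc₃ hβ in
/-- **THE KERNEL ENTRY `σ ↦ dC_k(1; B₂ + σΔ; D)(c)` IS ANALYTIC ON THE DISC `‖B₂‖ + |σ|‖Δ‖ ≤ b`** — the field twin of `analyticAt_dCov_background_line`: the entry is
`∂_s Q_k(1, B₂ + σΔ + sD)(c)|₀ − ∂_s Q_k(1, sD)(c)|₀` ((156), (134)), both jointly analytic in `(σ, s)` (`prop7_analyticAt` at `B′ ≡ 0`, parameter space `ℂ × ℂ`).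
[folklore] [cite: Balaban1985Averaging, Proposition 7 p.43, (156)–(157) p.42, (134) p.38] -/
theorem analyticAt_dCov_field_line (B₂ Δ : Site d → Fin d → 𝔸) {R : ℝ} (hBR : ∀ σ : ℂ, ‖σ‖ < R → ∀ x κ, ‖(B₂ + σ • Δ) x κ‖ ≤ b)
    (y : Site d) (μ : Fin d) (Xf : 𝔸) (z : Site d) (κ : Fin d) {σ : ℂ} (hσ : ‖σ‖ < R) :
    AnalyticAt ℂ (fun σ' : ℂ => dCov L 1 (B₂ + σ' • Δ) (bump y μ Xf) k z κ) σ := by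
  have hU₀ : ∀ (x : Site d) (κ' : Fin d), (1 : Site d → Fin d → 𝔸ˣ) x κ' ∈ G := fun _ _ => G.one_mem
  have h52 := pdev_one_lt (d := d) (𝔸 := 𝔸) L hL k hα
  have hc₃₇ : 2 * ((L : ℝ) ^ k * b) ≤ c3 d L / 4 := by
    have hx : (0 : ℝ) ≤ (L : ℝ) ^ k * b := by have := hb0.le; positivity
    linarith
  have h1exp : expCfg (0 : Site d → Fin d → 𝔸) * 1 = 1 := by rw [expCfg_zero', mul_one]
  have h0' : ∀ x κ', ‖(0 : Site d → Fin d → 𝔸) x κ'‖ ≤ ρ' := fun _ _ => by simpa using hρ'.le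
  set D : Site d → Fin d → 𝔸 := bump y μ Xf with hD
  have hDn : ∀ x κ', ‖D x κ'‖ ≤ ‖Xf‖ := fun x κ' => norm_bump_le y μ Xf x κ'
  set H₁ : ℂ × ℂ → 𝔸 := fun t => logCovIter L (expCfg ((fun _ : ℂ × ℂ => (0 : Site d → Fin d → 𝔸)) t) * 1) (B₂ + t.1 • Δ + t.2 • D) k z κ with hH₁
  set H₂ : ℂ × ℂ → 𝔸 := fun t => logCovIter L (expCfg ((fun _ : ℂ × ℂ => (0 : Site d → Fin d → 𝔸)) t) * 1) (t.2 • D) k z κ with hH₂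
  have hA₁ : ∀ σ' : ℂ, ‖σ'‖ < R → AnalyticAt ℂ H₁ (σ', 0) := fun σ' hσ' =>
    prop7_analyticAt L hL hG k 1 hU₀ hα hα3 hα8 h52 (E := ℂ × ℂ) (fun _ : ℂ × ℂ => (0 : Site d → Fin d → 𝔸)) (t₀ := (σ', 0))
      (fun x κ' => analyticAt_const) hρ'.le h0' hsmall' hc₃' hρ'1 (fun t : ℂ × ℂ => B₂ + t.1 • Δ + t.2 • D)
      (fun x κ' => ((analyticAt_const.add (analyticAt_fst.smul analyticAt_const)).add (analyticAt_snd.smul analyticAt_const) :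
        AnalyticAt ℂ (fun t : ℂ × ℂ => (B₂ + t.1 • Δ + t.2 • D) x κ') (σ', 0)))
      hb0.le (fun x κ' => by simpa using hBR σ' hσ' x κ') hsmall hc₃₇ k le_rfl z κ
  have hA₂ : ∀ σ' : ℂ, ‖σ'‖ < R → AnalyticAt ℂ H₂ (σ', 0) := fun σ' _ =>
    prop7_analyticAt L hL hG k 1 hU₀ hα hα3 hα8 h52 (E := ℂ × ℂ) (fun _ : ℂ × ℂ => (0 : Site d → Fin d → 𝔸)) (t₀ := (σ', 0))
      (fun x κ' => analyticAt_const) hρ'.le h0' hsmall' hc₃' hρ'1 (fun t : ℂ × ℂ => t.2 • D)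
      (fun x κ' => (analyticAt_snd.smul analyticAt_const : AnalyticAt ℂ (fun t : ℂ × ℂ => (t.2 • D) x κ') (σ', 0)))
      hb0.le (fun x κ' => by simpa using hb0.le) hsmall hc₃₇ k le_rfl z κ
  have hcurve : ∀ σ' : ℂ, HasDerivAt (fun s : ℂ => ((σ', s) : ℂ × ℂ)) ((0 : ℂ), (1 : ℂ)) 0 := fun σ' =>
    (hasDerivAt_const (0 : ℂ) σ').prodMk (hasDerivAt_id (0 : ℂ))
  have hEq' : ∀ σ' : ℂ, ‖σ'‖ < R → dCov L (expCfg (0 : Site d → Fin d → 𝔸) * 1) (B₂ + σ' • Δ) D k z κ =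
      (fderiv ℂ H₁ (σ', 0)) (0, 1) - (fderiv ℂ H₂ (σ', 0)) (0, 1) := by
    intro σ' hσ'
    have h156 := (prop5_cplx_156_uniform L hL hG k 1 hU₀ hα hα3 hα8 h52 0 hρ'.le h0' hsmall' hc₃' hρ'1 hE hdX (B₂ + σ' • Δ) hb0.le (hBR σ' hσ') hsmall hc₃ hβ
      y μ Xf le_rfl z κ).1
    have hd₁ : HasDerivAt (fun s : ℂ => logCovIter L (expCfg (0 : Site d → Fin d → 𝔸) * 1) (B₂ + σ' • Δ + s • D) k z κ)
        (dCov L (expCfg (0 : Site d → Fin d → 𝔸) * 1) (B₂ + σ' • Δ) D k z κ + linCovIter L (expCfg (0 : Site d → Fin d → 𝔸) * 1) D k z κ) 0 := h156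
    have hd₁' : HasDerivAt (fun s : ℂ => logCovIter L (expCfg (0 : Site d → Fin d → 𝔸) * 1) (B₂ + σ' • Δ + s • D) k z κ) ((fderiv ℂ H₁ (σ', 0)) (0, 1)) 0 := by
      have h := ((hA₁ σ' hσ').differentiableAt.hasFDerivAt.comp_hasDerivAt (0 : ℂ) (hcurve σ'))
      simp only [hH₁, Function.comp_def] at h
      exact h
    have hd₂ : HasDerivAt (fun s : ℂ => logCovIter L (expCfg (0 : Site d → Fin d → 𝔸) * 1) (s • D) k z κ)
        (linCovIter L (expCfg (0 : Site d → Fin d → 𝔸) * 1) D k z κ) 0 :=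
      hasDerivAt_logCovIter_line L hL hG k hα hα3 hα8 hb0 hsmall' hc₃' hρ'1 hsmall hc₃₇ 0 le_rfl (fun x κ' => by simp) hρ'.le D (norm_nonneg Xf) hDn z κ
    have hd₂' : HasDerivAt (fun s : ℂ => logCovIter L (expCfg (0 : Site d → Fin d → 𝔸) * 1) (s • D) k z κ) ((fderiv ℂ H₂ (σ', 0)) (0, 1)) 0 := by
      have h := ((hA₂ σ' hσ').differentiableAt.hasFDerivAt.comp_hasDerivAt (0 : ℂ) (hcurve σ'))
      simp only [hH₂, Function.comp_def] at h
      exact h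
    have e₁ := hd₁.unique hd₁'
    have e₂ := hd₂.unique hd₂'
    rw [e₂] at e₁
    exact eq_sub_of_add_eq e₁
  have hEq : ∀ σ' : ℂ, ‖σ'‖ < R → dCov L 1 (B₂ + σ' • Δ) D k z κ = (fderiv ℂ H₁ (σ', 0)) (0, 1) - (fderiv ℂ H₂ (σ', 0)) (0, 1) := fun σ' hσ' => by
    have h := hEq' σ' hσ'
    rwa [h1exp] at h
  have hS : ∀ {H : ℂ × ℂ → 𝔸}, AnalyticAt ℂ H (σ, 0) → AnalyticAt ℂ (fun σ' : ℂ => (fderiv ℂ H (σ', 0)) (0, 1)) σ := fun {H} hH => by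
    have hf : AnalyticAt ℂ (fun σ' : ℂ => ((σ', (0 : ℂ)) : ℂ × ℂ)) σ := analyticAt_id.prod analyticAt_const
    have h1 : AnalyticAt ℂ ((fderiv ℂ H) ∘ (fun σ' : ℂ => ((σ', (0 : ℂ)) : ℂ × ℂ))) σ := hH.fderiv.comp_of_eq hf rfl
    exact ((ContinuousLinearMap.apply ℂ 𝔸 ((0 : ℂ), (1 : ℂ))).analyticAt _).comp h1
  have hev : (fun σ' : ℂ => dCov L 1 (B₂ + σ' • Δ) D k z κ) =ᶠ[nhds σ]
      fun σ' : ℂ => (fderiv ℂ H₁ (σ', 0)) (0, 1) - (fderiv ℂ H₂ (σ', 0)) (0, 1) := by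
    filter_upwards [isOpen_ball.mem_nhds (mem_ball_zero_iff.2 hσ)] with σ' hσ'
    exact hEq σ' (mem_ball_zero_iff.1 hσ')
  exact ((hS (hA₁ σ hσ)).sub (hS (hA₂ σ hσ))).congr hev.symm

include hL hG hα hα3 hα8 hρ' hb0 hsmall' hc₃' hρ'1 hE hdX hsmall hc₃ hβ in
/-- **`‖dC_k(1; B₁; Xδ_b)(c) − dC_k(1; B₂; Xδ_b)(c)‖ ≤ (24∕b)·δ·C₃(Lᵏ)²L^{−kd}b‖X‖`** for `‖B₁(b′)‖ ≤ b`, `‖B₂(b′)‖ ≤ b∕2`, `‖B₁ − B₂‖_∞ ≤ δ` — the kernel entry at the flat background is Lipschitz in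
the field base point: for `12δ ≤ b` a CAUCHY ESTIMATE along `σ ↦ B₂ + σ(B₁ − B₂)` on `|σ| < b∕(2δ)` (§3's analyticity, the uniform bound (157) at field size `b`), `M∕(R − 2) ≤ 3M∕R`;
for `12δ > b` the two bounds (157) directly. [folklore] [cite: Balaban1985Averaging, Proposition 7 p.43, Prop. 5 (157) p.42, (137) p.39] -/
theorem norm_dCov_flat_sub_le (B₁ B₂ : Site d → Fin d → 𝔸) (hB₁ : ∀ x κ, ‖B₁ x κ‖ ≤ b) (hB₂ : ∀ x κ, ‖B₂ x κ‖ ≤ b / 2) {δ : ℝ} (hδ : 0 ≤ δ)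
    (hB₁₂ : ∀ x κ, ‖B₁ x κ - B₂ x κ‖ ≤ δ) (y : Site d) (μ : Fin d) (Xf : 𝔸) (z : Site d) (κ : Fin d) :
    ‖dCov L 1 B₁ (bump y μ Xf) k z κ - dCov L 1 B₂ (bump y μ Xf) k z κ‖ ≤
      24 / b * δ * (C3Cplx d L * ((L : ℝ) ^ k) ^ 2 * (((L : ℝ) ^ k) ^ d)⁻¹ * b * ‖Xf‖) := by
  have hL1 : 1 ≤ L := le_trans (by norm_num) hL
  have hC30 : 0 ≤ C3Cplx d L := (B7Prop5CplxLevels.C3Cplx_pos d hL1).le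
  set M : ℝ := C3Cplx d L * ((L : ℝ) ^ k) ^ 2 * (((L : ℝ) ^ k) ^ d)⁻¹ * b * ‖Xf‖ with hMdef
  have hM0 : 0 ≤ M := by rw [hMdef]; have := hb0.le; positivity
  have hU₀ : ∀ (x : Site d) (κ' : Fin d), (1 : Site d → Fin d → 𝔸ˣ) x κ' ∈ G := fun _ _ => G.one_mem
  have h52 := pdev_one_lt (d := d) (𝔸 := 𝔸) L hL k hα
  have h1exp : expCfg (0 : Site d → Fin d → 𝔸) * 1 = 1 := by rw [expCfg_zero', mul_one]
  have h0' : ∀ x κ', ‖(0 : Site d → Fin d → 𝔸) x κ'‖ ≤ ρ' := fun _ _ => by simpa using hρ'.le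
  -- the uniform bound (157) at the flat background for any field of size `≤ b`
  have h157 : ∀ B : Site d → Fin d → 𝔸, (∀ x κ', ‖B x κ'‖ ≤ b) → ‖dCov L 1 B (bump y μ Xf) k z κ‖ ≤ M := fun B hB => by
    have h := (prop5_cplx_157_uniform L hL hG k 1 hU₀ hα hα3 hα8 h52 0 hρ'.le h0' hsmall' hc₃' hρ'1 hE hdX B hb0.le hB hsmall hc₃ hβ y μ Xf le_rfl z κ).2.1
    rw [h1exp] at h
    exact h
  have hB₂' : ∀ x κ', ‖B₂ x κ'‖ ≤ b := fun x κ' => (hB₂ x κ').trans (by linarith)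
  rcases hδ.eq_or_lt with h0 | hpos
  · -- `δ = 0`: the two fields coincide
    have hB : B₁ = B₂ := by
      funext x κ'; have h := hB₁₂ x κ'; rw [← h0] at h; exact sub_eq_zero.1 (norm_le_zero_iff.1 h)
    rw [hB, sub_self, norm_zero, ← h0]; positivity
  rcases lt_or_ge b (12 * δ) with hbig | hbig
  · -- large `δ`: the two bounds (157)
    have h2 : (2 : ℝ) ≤ 24 / b * δ := by rw [div_mul_eq_mul_div, le_div_iff₀ hb0]; linarith
    calc _ ≤ ‖dCov L 1 B₁ (bump y μ Xf) k z κ‖ + ‖dCov L 1 B₂ (bump y μ Xf) k z κ‖ := norm_sub_le _ _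
      _ ≤ M + M := add_le_add (h157 B₁ hB₁) (h157 B₂ hB₂')
      _ = 2 * M := by ring
      _ ≤ 24 / b * δ * M := mul_le_mul_of_nonneg_right h2 hM0
  · -- the line `σ ↦ B₂ + σΔ`, `Δ = B₁ − B₂`, radius `R = b/(2δ) ≥ 6`
    set Δ : Site d → Fin d → 𝔸 := B₁ - B₂ with hΔ
    have hΔn : ∀ x κ', ‖Δ x κ'‖ ≤ δ := fun x κ' => by rw [hΔ, Pi.sub_apply, Pi.sub_apply]; exact hB₁₂ x κ'
    set R : ℝ := b / (2 * δ) with hRdef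
    have hR : 0 < R := by rw [hRdef]; positivity
    have hR6 : 6 ≤ R := by rw [hRdef, le_div_iff₀ (by positivity)]; linarith
    have hRδ : 2 * R * δ = b := by rw [hRdef]; field_simp
    have hBR : ∀ σ : ℂ, ‖σ‖ < R → ∀ x κ', ‖(B₂ + σ • Δ) x κ'‖ ≤ b := fun σ hσ x κ' => by
      simp only [Pi.add_apply, Pi.smul_apply]
      calc ‖B₂ x κ' + σ • Δ x κ'‖ ≤ ‖B₂ x κ'‖ + ‖σ‖ * ‖Δ x κ'‖ := (norm_add_le _ _).trans (add_le_add le_rfl (norm_smul_le _ _))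
        _ ≤ b / 2 + R * δ := add_le_add (hB₂ x κ') (mul_le_mul hσ.le (hΔn x κ') (norm_nonneg _) hR.le)
        _ = b := by linarith [hRδ]
    set g : ℂ → 𝔸 := fun σ => dCov L 1 (B₂ + σ • Δ) (bump y μ Xf) k z κ with hgdef
    have g1 : g 1 = dCov L 1 B₁ (bump y μ Xf) k z κ := by simp only [hgdef, one_smul, hΔ, add_sub_cancel]
    have g0 : g 0 = dCov L 1 B₂ (bump y μ Xf) k z κ := by simp only [hgdef, zero_smul, add_zero]
    have hd : DifferentiableOn ℂ g (ball (0 : ℂ) R) := fun σ hσ =>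
      (analyticAt_dCov_field_line L hL hG k hα hα3 hα8 hρ' hb0 hsmall' hc₃' hρ'1 hE hdX hsmall hc₃ hβ B₂ Δ hBR y μ Xf z κ
        (mem_ball_zero_iff.1 hσ)).differentiableAt.differentiableWithinAt
    have hM : ∀ σ : ℂ, ‖σ‖ < R → ‖g σ‖ ≤ M := fun σ hσ => h157 _ (hBR σ hσ)
    have hr : 0 < R - 2 := by linarith
    have hsub : ∀ t : ℝ, t ∈ Icc (0 : ℝ) 1 → closedBall (t : ℂ) (R - 2) ⊆ ball (0 : ℂ) R := fun t ht w hw => by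
      rw [mem_closedBall, dist_eq_norm] at hw
      rw [mem_ball_zero_iff]
      have ht1 : ‖(t : ℂ)‖ ≤ 1 := by rw [Complex.norm_real, Real.norm_of_nonneg ht.1]; exact ht.2
      calc ‖w‖ = ‖(w - t) + t‖ := by rw [sub_add_cancel]
        _ ≤ ‖w - (t : ℂ)‖ + ‖(t : ℂ)‖ := norm_add_le _ _
        _ < R := by linarith
    have hMs : ∀ t : ℝ, t ∈ Icc (0 : ℝ) 1 → ∀ w ∈ sphere (t : ℂ) (R - 2), ‖g w‖ ≤ M := fun t ht w hw =>
      hM w (mem_ball_zero_iff.1 (hsub t ht (sphere_subset_closedBall hw)))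
    have hC := norm_sub_le_of_sphere_bound isOpen_ball hd hr hsub hMs
    rw [g1, g0] at hC
    refine hC.trans ?_
    have hR2 : R / 3 ≤ R - 2 := by linarith
    calc M / (R - 2) ≤ M / (R / 3) := div_le_div_of_nonneg_left hM0 (by positivity) hR2
      _ = 6 / b * δ * M := by rw [hRdef]; field_simp; ring
      _ ≤ 24 / b * δ * M :=
          mul_le_mul_of_nonneg_right (mul_le_mul_of_nonneg_right (div_le_div_of_nonneg_right (by norm_num) hb0.le) hδ) hM0

include hL hG hα hα3 hα8 hρ' hb0 hsmall' hc₃' hρ'1 hE hdX hsmall hc₃ hβ in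
/-- **LOCALITY AT THE FLAT BACKGROUND**: `dC_k(1; B; Xδ_b)(c) = 0` unless `b ⊂ Bᵏ(c₋) ∪ Bᵏ(c₊)`, for every field of size `≤ b` ((157) «zero unless …»). [folklore]
[cite: Balaban1985Averaging, Prop. 5 (157) p.42, (141) p.39] -/
theorem dCov_flat_eq_zero_off (B : Site d → Fin d → 𝔸) (hB : ∀ x κ, ‖B x κ‖ ≤ b) (y : Site d) (μ : Fin d) (Xf : 𝔸) (z : Site d) (κ : Fin d)
    (hoff : ¬ BondIn (loK L k z) (bondHiK L k z κ) y μ) : dCov L 1 B (bump y μ Xf) k z κ = 0 := by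
  have hU₀ : ∀ (x : Site d) (κ' : Fin d), (1 : Site d → Fin d → 𝔸ˣ) x κ' ∈ G := fun _ _ => G.one_mem
  have h52 := pdev_one_lt (d := d) (𝔸 := 𝔸) L hL k hα
  have h1exp : expCfg (0 : Site d → Fin d → 𝔸) * 1 = 1 := by rw [expCfg_zero', mul_one]
  have h0' : ∀ x κ', ‖(0 : Site d → Fin d → 𝔸) x κ'‖ ≤ ρ' := fun _ _ => by simpa using hρ'.le
  have h := (prop5_cplx_157_uniform L hL hG k 1 hU₀ hα hα3 hα8 h52 0 hρ'.le h0' hsmall' hc₃' hρ'1 hE hdX B hb0.le hB hsmall hc₃ hβ y μ Xf le_rfl z κ).2.2 hoff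
  rw [h1exp] at h
  exact h

end Literature.MathematicalPhysics.QuantumFieldTheory.Balaban1983to89.B7Prop7KernelBackgroundModulusLevels

end
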